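import Literature.NumberTheory.DiophantineGeometry.EllArithGlue
import Literature.NumberTheory.DiophantineGeometry.MinimalDiscriminantSpanProofs
import Literature.NumberTheory.DiophantineGeometry.MinimalDiscriminantRingOfIntegersProofs
import HarnessLib

/-!
# Discharge of `minimalDiscriminantNorm_int_eq_natAbs_minimalDiscriminantInt` (glue G22/G06)

Sibling proof file of `Literature.NumberTheory.DiophantineGeometry.EllArithGlue`. It proves the
named fact `WeierstrassCurve.minimalDiscriminantNorm_int_eq_natAbs_minimalDiscriminantInt`:
for a globally minimal Weierstrass equation `W` of an elliptic curve over `ℚ`,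
`N(𝔇_min) = |Δ_min|`, i.e. `W.minimalDiscriminantNorm ℤ = (minimalDiscriminantInt W).natAbs`.

## Proof

Following the route recorded in the docstring of the fact (Silverman, *AEC* VIII.8: over a global
minimal equation the minimal discriminant ideal is `(Δ)`):

* `W.minimalDiscriminantNorm ℤ = W.minimalDiscriminantNorm (𝓞 ℚ)`
  (`minimalDiscriminantNorm_ringOfIntegers_rat_holds`, file `MinimalDiscriminantRingOfIntegersProofs`);
* with `W₀ = W.integralModel (𝓞 ℚ)` (so `W₀ ⁄ ℚ = W`, Mathlib `baseChange_integralModel_eq`), global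
  minimality of `W` says `W₀ ⁄ ℚ` is minimal at every finite place of `𝓞 ℚ`, hence
  `𝔇_min = (Δ(W₀))` (`minimalDiscriminantIdeal_eq_span_holds`, file `MinimalDiscriminantSpanProofs`);
* `N((Δ(W₀))) = |N_{𝓞 ℚ/ℤ} Δ(W₀)|` (Mathlib `Ideal.absNorm_span_singleton`) and the norm of the rank-one
  `ℤ`-algebra `𝓞 ℚ ≃ ℤ` is the identity (`Algebra.norm_eq_of_algEquiv`, `Algebra.norm_self`), while
  `minimalDiscriminantInt W = Δ(W₀.map (𝓞 ℚ ≃ ℤ))` by definition.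

## References

* J. H. Silverman, *The Arithmetic of Elliptic Curves*, GTM 106, 2nd ed. (2009), VIII.8
  (Definitions preceding Lemma 8.1; Cor. 8.3). [cite: SilvermanAEC2009, VIII.8]
-/

noncomputable section

open scoped Classical
open NumberField IsDedekindDomain

namespace WeierstrassCurve

/-- The `ℤ`-norm on the rank-one `ℤ`-algebra `𝓞 ℚ` is the ring isomorphism `𝓞 ℚ ≃ ℤ`
(`Rat.ringOfIntegersEquiv`, viewed as an isomorphism of `ℤ`-algebras; the norm is invariant under
algebra isomorphisms and is the identity on `ℤ`). [folklore] -/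
theorem algebraNorm_int_ringOfIntegers_rat (x : 𝓞 ℚ) :
    Algebra.norm ℤ x = Rat.ringOfIntegersEquiv x := by
  let e : 𝓞 ℚ ≃ₐ[ℤ] ℤ := AlgEquiv.ofRingEquiv (f := Rat.ringOfIntegersEquiv) fun n => by simp
  have he : e x = Rat.ringOfIntegersEquiv x := rfl
  rw [← he, ← Algebra.norm_eq_of_algEquiv e x, Algebra.norm_self]
  rfl

/-- **Discharge** of `WeierstrassCurve.minimalDiscriminantNorm_int_eq_natAbs_minimalDiscriminantInt`
(`N(𝔇_min) = |Δ_min|` over `ℚ` for a globally minimal equation of an elliptic curve).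
Silverman, *AEC* 2nd ed., VIII.8: the minimal discriminant ideal of a global minimal Weierstrass
equation is the principal ideal generated by its discriminant (Definitions preceding Lemma 8.1),
and over `ℚ` a global minimal equation exists (Cor. 8.3). [cite: SilvermanAEC2009, VIII.8] -/
theorem minimalDiscriminantNorm_int_eq_natAbs_minimalDiscriminantInt_holds :
    minimalDiscriminantNorm_int_eq_natAbs_minimalDiscriminantInt := by
  intro W _ hW
  have h1 : W.minimalDiscriminantNorm (𝓞 ℚ) = W.minimalDiscriminantNorm ℤ :=
    minimalDiscriminantNorm_ringOfIntegers_rat_holds W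
  rw [← h1]
  have hΔ : (W.integralModel (𝓞 ℚ)).Δ ≠ 0 := IsGloballyMinimal.Δ_ne_zero W
  have hbc : (W.integralModel (𝓞 ℚ)).baseChange ℚ = W := baseChange_integralModel_eq (𝓞 ℚ) W
  have hmin : ∀ v : HeightOneSpectrum (𝓞 ℚ), ((W.integralModel (𝓞 ℚ)).baseChange ℚ).IsMinimalAt v := by
    intro v
    rw [hbc]
    exact hW.isMinimal v
  have h2 := minimalDiscriminantIdeal_eq_span_holds (𝓞 ℚ) (K := ℚ) (W.integralModel (𝓞 ℚ)) hΔ hmin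
  rw [hbc] at h2
  unfold minimalDiscriminantNorm
  rw [h2, Ideal.absNorm_span_singleton, algebraNorm_int_ringOfIntegers_rat, minimalDiscriminantInt,
    integralModelInt, map_Δ]
  rfl

end WeierstrassCurve

end
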